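import Summits.BirchSwinnertonDyer.BirchSwinnertonDyer.Theorems.GenusKolyvaginAtTwoPowDvdShaCardAtTwoRTGenusParity
import HarnessLib

/-!
# Route `GenusKolyvaginAtTwo`, LINE 18 v5 (L_T `PowDvdShaCardAtTwoRT`, stmt-BirchSwinnertonDyer-23242): THE GENUS BUDGET IS AT MOST
# TWO BITS PER PRIME OF `d_K`, AND EXACTLY ONE BIT WHEN `|d_K|` IS PRIME

Seat `bsd-line-gk2-p2` g17 (cell `bsd-f1-sign2`), `--supports stmt-BirchSwinnertonDyer-23242` (helper; closes nothing).
THEOREMS ONLY (no definition, no named fact, no `sorry`); BSD is not proved by any of this.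

WHY.  LINE 18 v5 splits the lever 3a⁗ by the genus budget `B := ord₂ C(Wd) = Σ_{q ∣ d_K} dim Ẽ(𝔽_q)[2]` (gk2-p3
`padicValNat_two_tamagawaProduct_twin_eq`): the SHALLOW regime `B ≤ 1` is a theorem of the ladder stub L (frame theorem), while the
DEEP regime `B ≥ 2` (on `Δ < 0`: `B ≥ 3`, GP) carries BOTH open fronts of the line — the cross-side count J (refuted as typed by genus
ladders, `…RTGenusLadder`, memo `Lines/plus-descent-stubJ-audit.md`) and the LEAD's bottom-rung residual `R_δ` (`δ = Σ_{q∣d_K} dim W(ℚ_q)[2]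
= B`).  This file records the size of the budget in the pen's currency, for the habitat-cut option (D1)/(α′):

* `ncard_twoTorsionRoots_le_three` — a prime `q ≠ 2` sees at most three roots of `4x³ + b₂x² + 2b₄x + b₆` (a genuine cubic mod `q`);
  `padicValNat_two_succ_le_two_of_le_three` — hence `ord₂(1 + #roots) ≤ 2` (one prime of `d_K` costs at most two bits);
* `padicValNat_two_tamagawaProduct_twin_le` — `ord₂ C(Wd) ≤ ord₂ C(W) + 2·#{q ∣ d_K}` on the Heegner twin frame;
* `padicValNat_two_tamagawaProduct_twin_eq_one_of_prime` — **`|d_K|` prime, `C(W)` odd, `Δ_W < 0 ⇒ ord₂ C(Wd) = 1`** (`≤ 2` by the above,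
  odd by GP `odd_padicValNat_two_tamagawaProduct_twin_of_Δ_neg`): for prime `|d_K|` every habitat row is SHALLOW, so there
  `stub_twinExhibitionGenusShallow` (a theorem of L) is all of 3a⁗ and neither J nor `R_δ` is needed;
  `padicValNat_two_tamagawaProduct_twin_le_one_of_prime` — the same as the hypothesis `ord₂ C(Wd) ≤ 1` of the Shallow stub verbatim.

References: [Kramer1981] §2 Prop. 3; [GrossLMS1991] §1 (Heegner hypothesis); [SilvermanATAEC1994] IV.9.4 Step 6.
-/

set_option autoImplicit false
-- the Theorems namespace of this sub repeats the summit name by design (D-0017 nested layout)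
set_option linter.dupNamespace false

noncomputable section

open scoped Classical

namespace Summit.BirchSwinnertonDyer.BirchSwinnertonDyer.Theorems.GenusExact.PlusDescent

open WeierstrassCurve NumberField Literature.NumberTheory.EllipticCurves

/-! ## §1 One prime of `d_K` costs at most two bits -/

/-- **At most three roots of the `2`-division cubic modulo an odd prime**: for `q ≠ 2` prime and any integers `b₂, b₄, b₆`,
`#{x̄ ∈ 𝔽_q : 4x̄³ + b₂x̄² + 2b₄x̄ + b₆ = 0} ≤ 3` (the leading coefficient `4` is a unit, Mathlib `Cubic.card_roots_le`). [folklore] -/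
theorem ncard_twoTorsionRoots_le_three {q : ℕ} [hq : Fact q.Prime] (hq2 : q ≠ 2) (b₂ b₄ b₆ : ℤ) :
    {x : ZMod q | 4 * x ^ 3 + (b₂ : ZMod q) * x ^ 2 + 2 * (b₄ : ZMod q) * x + (b₆ : ZMod q) = 0}.ncard ≤ 3 := by
  set P : Cubic (ZMod q) := ⟨4, (b₂ : ZMod q), 2 * (b₄ : ZMod q), (b₆ : ZMod q)⟩ with hP
  have h2 : (2 : ZMod q) ≠ 0 := by
    have : ((2 : ℕ) : ZMod q) ≠ 0 := by
      rw [Ne, ZMod.natCast_eq_zero_iff]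
      intro h
      exact hq2 ((Nat.prime_dvd_prime_iff_eq hq.out Nat.prime_two).mp h)
    exact_mod_cast this
  have h4 : (4 : ZMod q) ≠ 0 := by
    have : (4 : ZMod q) = 2 * 2 := by norm_num
    rw [this]; exact mul_ne_zero h2 h2
  have hP0 : P.toPoly ≠ 0 := Cubic.ne_zero_of_a_ne_zero (P := P) h4
  have hS : {x : ZMod q | 4 * x ^ 3 + (b₂ : ZMod q) * x ^ 2 + 2 * (b₄ : ZMod q) * x + (b₆ : ZMod q) = 0} =
      ↑P.roots.toFinset := by
    ext x
    rw [Set.mem_setOf_eq, Finset.mem_coe, Multiset.mem_toFinset, Cubic.mem_roots_iff hP0]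
  rw [hS, Set.ncard_coe_finset]
  exact Cubic.card_roots_le

/-- `ord₂ (n + 1) ≤ 2` for `n ≤ 3` (`n + 1 ≤ 4 = 2²`). [folklore] -/
theorem padicValNat_two_succ_le_two_of_le_three {n : ℕ} (hn : n ≤ 3) : padicValNat 2 (n + 1) ≤ 2 := by
  refine (padicValNat_le_nat_log (n + 1)).trans ?_
  calc Nat.log 2 (n + 1) ≤ Nat.log 2 4 := Nat.log_mono_right (by omega)
    _ = 2 := by
      have : (4 : ℕ) = 2 ^ 2 := by norm_num
      rw [this, Nat.log_pow Nat.one_lt_two]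

/-! ## §2 The budget on the Heegner twin frame -/

section Twin

variable (W : WeierstrassCurve ℚ) [W.IsElliptic] [W.IsGloballyMinimal] {K : Type} [Field K] [NumberField K]

/-- **`ord₂ C(Wd) ≤ ord₂ C(W) + 2·#{q ∣ d_K}`** on the Heegner twin frame (`W/ℚ` globally minimal elliptic, `K` imaginary quadratic
with odd `d_K` and the Heegner hypothesis for `N_W`, `Wd = Cd • W^{(d_K)}` elliptic): each prime of `d_K` contributes
`ord₂(1 + #roots) ≤ 2` to gk2-p3's place-by-place formula. [cite: Kramer1981, §2 Prop. 3] [cite: SilvermanATAEC1994, IV.9.4 Step 6] -/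
theorem padicValNat_two_tamagawaProduct_twin_le (hK : IsImaginaryQuadratic K) (hodd : Odd (NumberField.discr K))
    (hH : SatisfiesHeegnerHypothesis (W.conductorNorm ℤ) K) {Wd : WeierstrassCurve ℚ} [Wd.IsElliptic]
    (Cd : VariableChange ℚ) (hWd : Cd • W.quadraticTwist (NumberField.discr K : ℚ) = Wd) :
    padicValNat 2 Wd.tamagawaProduct ≤
      padicValNat 2 W.tamagawaProduct + 2 * (NumberField.discr K).natAbs.primeFactors.card := by
  rw [padicValNat_two_tamagawaProduct_twin_eq W hK hodd hH Cd hWd, Nat.add_le_add_iff_left, mul_comm,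
    ← smul_eq_mul, ← Finset.sum_const]
  refine Finset.sum_le_sum fun q hq ↦ ?_
  obtain ⟨hqP, hqdvd, -⟩ := Nat.mem_primeFactors.mp hq
  haveI := Fact.mk hqP
  have hq2 : q ≠ 2 := by
    rintro rfl
    exact (Int.not_even_iff_odd.mpr hodd) (even_iff_two_dvd.mpr (Int.natCast_dvd.mpr hqdvd))
  exact padicValNat_two_succ_le_two_of_le_three (ncard_twoTorsionRoots_le_three hq2 _ _ _)

/-- **`|d_K|` PRIME, `C(W)` ODD, `Δ_W < 0 ⇒ ord₂ C(Wd) = 1`**: the genus budget of a Heegner twin by a prime discriminant is exactly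
one bit — `≤ 2` (one prime, `padicValNat_two_tamagawaProduct_twin_le`) and odd (GP `odd_padicValNat_two_tamagawaProduct_twin_of_Δ_neg`:
the single prime `q = |d_K|` is a transposition prime, `Ẽ(𝔽_q)[2] ≅ ℤ/2`).  So on prime `|d_K|` every row of L_T is in the SHALLOW
regime of LINE 18 v5.  [cite: Kramer1981, §2 Prop. 3] [cite: IrelandRosen1990, Prop. 5.2.2] -/
theorem padicValNat_two_tamagawaProduct_twin_eq_one_of_prime (hK : IsImaginaryQuadratic K) (hodd : Odd (NumberField.discr K))
    (hH : SatisfiesHeegnerHypothesis (W.conductorNorm ℤ) K) (hT : Odd W.tamagawaProduct) (hΔ : W.Δ < 0)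
    (hprime : (NumberField.discr K).natAbs.Prime) {Wd : WeierstrassCurve ℚ} [Wd.IsElliptic]
    (Cd : VariableChange ℚ) (hWd : Cd • W.quadraticTwist (NumberField.discr K : ℚ) = Wd) :
    padicValNat 2 Wd.tamagawaProduct = 1 := by
  have hle := padicValNat_two_tamagawaProduct_twin_le W hK hodd hH Cd hWd
  have hW0 : padicValNat 2 W.tamagawaProduct = 0 :=
    padicValNat.eq_zero_of_not_dvd fun h ↦ (Nat.not_even_iff_odd.mpr hT) (even_iff_two_dvd.mpr h)
  rw [hW0, Nat.Prime.primeFactors hprime, Finset.card_singleton] at hle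
  obtain ⟨k, hk⟩ := odd_padicValNat_two_tamagawaProduct_twin_of_Δ_neg W hK hodd hH hT hΔ Cd hWd
  omega

/-- **Prime `|d_K|` puts L_T in the Shallow regime**: the hypothesis `ord₂ C(Wd) ≤ 1` of `stub_twinExhibitionGenusShallow` (LINE 18 v5,
a THEOREM of the ladder stub L by gk2-p3's frame theorem), in its own binders (`Wd` globally minimal, twin given existentially).
[cite: Kramer1981, §2 Prop. 3] -/
theorem padicValNat_two_tamagawaProduct_twin_le_one_of_prime (hK : IsImaginaryQuadratic K) (hodd : Odd (NumberField.discr K))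
    (hH : SatisfiesHeegnerHypothesis (W.conductorNorm ℤ) K) (hT : Odd W.tamagawaProduct) (hΔ : W.Δ < 0)
    (hprime : (NumberField.discr K).natAbs.Prime) (Wd : WeierstrassCurve ℚ) [Wd.IsElliptic] [Wd.IsGloballyMinimal]
    (hTw : ∃ C : VariableChange ℚ, C • W.quadraticTwist (NumberField.discr K : ℚ) = Wd) :
    padicValNat 2 Wd.tamagawaProduct ≤ 1 := by
  obtain ⟨Cd, hWd⟩ := hTw
  exact (padicValNat_two_tamagawaProduct_twin_eq_one_of_prime W hK hodd hH hT hΔ hprime Cd hWd).le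

end Twin

end Summit.BirchSwinnertonDyer.BirchSwinnertonDyer.Theorems.GenusExact.PlusDescent

end
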